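import Literature.NumberTheory.EllipticCurves.FormalGroupDivision
import Literature.RingTheory.DiscreteValuationRing.AdicCompletionHensel
import Literature.RingTheory.DiscreteValuationRing.AdicCompletionResidueField
import Literature.NumberTheory.EllipticCurves.VariableChangePoints
import Mathlib.Analysis.SpecificLimits.Basic
import HarnessLib

/-!
# `E(K_v)` has a finite-index torsion-free subgroup `U` with `[U : nU] = (O_v : n O_v)`;
# `#E(K_v)/n = #E(K_v)[n] · #O_v/n` (Silverman AEC VII.6.3, Milne ADT I Lemma 3.3)

Topic `NumberTheory/EllipticCurves`; theorems only (no definition, no named fact, no instance).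
For an elliptic curve `W` over a number field `K` and a finite place `v`, with
`K_v = v.adicCompletion K`, `O_v = v.adicCompletionIntegers K` and
`E(K_v) = (W ⊗ K_v)(K_v)` (Mathlib points of `W.baseChange K_v`):

* `WeierstrassCurve.exists_finiteIndex_torsionFree_adicCompletion` — **Silverman, *AEC*
  Prop. VII.6.3** ("`E(K)` contains a subgroup of finite index that is isomorphic to `R⁺`", `K/ℚ_p`
  finite, `R` its valuation ring) in the form its consumers use: a subgroup `U ≤ E(K_v)` of finite
  index, torsion-free, with `[U : n U] = (O_v : n O_v)` for every `n ≠ 0`;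
* `WeierstrassCurve.card_quotient_range_nsmul_adicCompletion` — **Milne, *ADT* I Lemma 3.3**, the
  count `[A(K)⁽ⁿ⁾]/[A(K)ₙ] = (R : nR)^{dim A}` for `A = E`: `#E(K_v)/n E(K_v) = #E(K_v)[n] · #O_v/n O_v`,
  with the finiteness of `E(K_v)[n]` and of `E(K_v)/n E(K_v)`
  (`finite_ker_nsmul_adicCompletion`, `finite_quotient_range_nsmul_adicCompletion`).

The tree had these for `K_v = ℚ_p` only (`exists_finiteIndex_addEquiv_padicInt_holds`,
`brumerKramer_card_quotient_two_holds`, file `PadicPointsFiniteIndexProofs`, via the `p`-adic formal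
logarithm).  Use: with the local Euler characteristic `χ(K_v, E[n]) = (O_v : n O_v)⁻²` this count is
the order computation `#H¹(K_v, E)[n] = #E(K_v)/n` of Tate local duality for `E` (Milne I Thm. 3.2,
Cor. 3.4), i.e. the maximality of the local Kummer images `E(K_v)/n ↪ H¹(K_v, E[n])` required by
Milne I Lemma 6.15 in the proof of the non-degeneracy of the Cassels–Tate pairing
(`WeierstrassCurve.exists_casselsTate_pairing`).

## Proof (Silverman VII.6.3 / IV.3.2 / IV.6.4 / VII.2.2, in the chart language of the tree)

`U = U_{‖p‖²} = {P ∈ E₁(K_v) : ‖z(P)‖ ≤ ‖p‖²}` for an `O_v`-integral equation (`p` the residue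
characteristic, `z = -x/y`), a level of the filtration of the kernel of reduction
(`FormalGroupChart.kernelLevel`, file `FormalGroupDivision`).  The inputs of `FormalGroupDivision`
are discharged here for `K_v` with the norm valuation `‖·‖₊` (`NormedField.valuation`):
`hcomplete` = `LocalPoints.exists_limit_of_geometric` (completeness of `K_v`, ultrametric error
bound), `hlift` = `LocalPoints.exists_mem_kernel_zCoord_eq` (**`z : E₁(K_v) → 𝔪_v` is onto**,
Silverman VII.2.2, by Hensel's lemma in `O_v` — `Literature/RingTheory/DiscreteValuationRing/
AdicCompletionHensel` — on the monic cubic of `FormalGroupChart.approxRoot`), `hunit` = the residue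
characteristic (`‖n‖ = 1` for `p ∤ n`, `‖p‖ < 1`).  Then: `U` is torsion-free
(`FormalGroupChart.eq_zero_of_nsmul_eq_zero`); `[U : n U] = [B_{‖p‖²} : B_{‖n‖‖p‖²}]`
(`relIndex_map_nsmul_kernelLevel_eq`) `= (O_v : n O_v)` (`LocalPoints.relIndex_leAddSubgroup_eq`:
`a ↦ p² a` is `O_v ≅ B_{‖p‖²}`); `[E(K_v) : E₁(K_v)] < ∞` is the tree's uniform compactness argument
`WeierstrassCurve.index_ne_zero_of_forall_some_mem` (`TamagawaNeZeroProofs`, Silverman VII.6.2 /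
Exercise 7.6) and `[E₁(K_v) : U] ≤ [O_v : p² O_v] < ∞` (`relIndex_kernelLevel_ne_zero`); the
transfer from an `O_v`-integral scaling `C • (W ⊗ K_v)` (Mathlib `exists_isIntegral`) is along the
tree's `VariableChange.pointEquiv`.  The count is the Herbrand-quotient identity
`[G : nG] = [U : nU] · #G[n]` for a torsion-free finite-index `U` (`LocalPoints.index_range_nsmul_eq`).

## References

* [SilvermanAEC2009] J. H. Silverman, *The Arithmetic of Elliptic Curves*, 2nd ed., GTM 106 (2009),
  Prop. VII.6.3 (p. 194 of the 2nd ed.: "`E(K)` contains a subgroup of finite index that is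
  isomorphic to `R⁺`"; proof via VII.6.1/VII.6.2, VII.2.1–2.2, IV.6.4(b)), Prop. VII.2.2,
  Prop. IV.3.2, Thm. IV.6.4, Cor. VII.6.2 / Exercise 7.6.
* [MilneADT2006] J. S. Milne, *Arithmetic Duality Theorems*, 2nd ed. (2006), I Lemma 3.3 (p. 41:
  "`A(K)` contains an open subgroup of finite index isomorphic to `R^{dim A}`; therefore […]
  `[A(K)⁽ⁿ⁾]/[A(K)ₙ] = (R : nR)^{dim A}`"), Thm. 3.2 and its proof (p. 43), Cor. 3.4, Lemma 6.15.

## Design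

`noncomputable section`; `open scoped Classical NNReal`; helper results in
`namespace Literature.NumberTheory.EllipticCurves.LocalPoints` (norm valuation of `K_v`, residue
characteristic, completeness, Hensel lift, ball indices, Herbrand identity, transfer), the four
consumer theorems as `WeierstrassCurve.…` dot-extensions.  No `def`, no `instance` (integrality of
`W₀ ⊗ K_v` for the norm valuation is the theorem `LocalPoints.isIntegral_baseChange`, fed by
`haveI`).  Axioms: `propext`, `Classical.choice`, `Quot.sound`.
-/

noncomputable section

namespace Literature.NumberTheory.EllipticCurves

open scoped Classical NNReal
open NumberField IsDedekindDomain FormalGroupChart _root_.WeierstrassCurve Polynomial Filter Topology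

universe u

namespace LocalPoints

variable {K : Type u} [Field K] [NumberField K] (v : HeightOneSpectrum (𝓞 K))


/-! ### The norm valuation of `K_v` and its ring of integers -/

/-- The norm valuation of `K_v` is `x ↦ ‖x‖₊`. [folklore] -/
theorem valuation_apply (x : (v.adicCompletion K)) : (NormedField.valuation : Valuation (v.adicCompletion K) ℝ≥0) x = ‖x‖₊ := rfl

/-- `‖x‖ ≤ 1 ↔ x ∈ O_v`. [folklore] -/
theorem norm_le_one_iff_mem (x : (v.adicCompletion K)) : ‖x‖ ≤ 1 ↔ x ∈ (v.adicCompletionIntegers K) := by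
  rw [Valued.toNormedField.norm_le_one_iff, HeightOneSpectrum.mem_adicCompletionIntegers]

/-- Elements of `O_v` have norm `≤ 1`. [folklore] -/
theorem valuation_coe_le_one (a : (v.adicCompletionIntegers K)) : (NormedField.valuation : Valuation (v.adicCompletion K) ℝ≥0) (a : (v.adicCompletion K)) ≤ 1 := by
  rw [valuation_apply, ← NNReal.coe_le_coe, coe_nnnorm, NNReal.coe_one]
  exact (norm_le_one_iff_mem v _).mpr a.2

/-- A unit of `O_v` has norm `1`, a non-unit has norm `< 1`. [folklore] -/
theorem isUnit_iff_valuation_eq_one (a : (v.adicCompletionIntegers K)) : IsUnit a ↔ (NormedField.valuation : Valuation (v.adicCompletion K) ℝ≥0) (a : (v.adicCompletion K)) = 1 := by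
  have hv : (Valued.v : Valuation (v.adicCompletion K) (WithZero (Multiplicative ℤ))).Integers (v.adicCompletionIntegers K) :=
    Valuation.valuationSubring.integers _
  rw [hv.isUnit_iff_valuation_eq_one, valuation_apply, ← NNReal.coe_inj, coe_nnnorm, NNReal.coe_one]
  constructor
  · intro h
    exact le_antisymm ((norm_le_one_iff_mem v _).mpr a.2)
      (Valued.toNormedField.one_le_norm_iff.mpr h.ge)
  · intro h
    exact le_antisymm (Valued.toNormedField.norm_le_one_iff.mp h.le)
      (Valued.toNormedField.one_le_norm_iff.mp h.ge)

/-- `a ∈ 𝔪_v ↔ ‖a‖ < 1`. [folklore] -/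
theorem mem_maximalIdeal_iff (a : (v.adicCompletionIntegers K)) : a ∈ IsLocalRing.maximalIdeal (v.adicCompletionIntegers K) ↔ (NormedField.valuation : Valuation (v.adicCompletion K) ℝ≥0) (a : (v.adicCompletion K)) < 1 := by
  rw [IsLocalRing.mem_maximalIdeal, mem_nonunits_iff, isUnit_iff_valuation_eq_one]
  exact ⟨fun h ↦ lt_of_le_of_ne (valuation_coe_le_one v a) h, fun h ↦ h.ne⟩

/-- For a Weierstrass equation `W₀` over `O_v`, `W₀ ⊗ K_v` is integral for the norm valuation.
[folklore] -/
theorem isIntegral_baseChange (W₀ : WeierstrassCurve (v.adicCompletionIntegers K)) :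
    (W₀.baseChange (v.adicCompletion K)).IsIntegral ((NormedField.valuation : Valuation (v.adicCompletion K) ℝ≥0)).integer := by
  refine isIntegral_of_exists_lift _ ?_ ?_ ?_ ?_ ?_
  · exact ⟨⟨(W₀.a₁ : (v.adicCompletion K)), valuation_coe_le_one v _⟩, rfl⟩
  · exact ⟨⟨(W₀.a₂ : (v.adicCompletion K)), valuation_coe_le_one v _⟩, rfl⟩
  · exact ⟨⟨(W₀.a₃ : (v.adicCompletion K)), valuation_coe_le_one v _⟩, rfl⟩
  · exact ⟨⟨(W₀.a₄ : (v.adicCompletion K)), valuation_coe_le_one v _⟩, rfl⟩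
  · exact ⟨⟨(W₀.a₆ : (v.adicCompletion K)), valuation_coe_le_one v _⟩, rfl⟩

/-! ### The residue characteristic: `|p| < 1`, `|n| = 1` for `p ∤ n` -/

/-- The natural number `n` of `K`, coerced into `K_v`, is the natural number `n` of `K_v`.
[folklore] -/
theorem coe_natCast (n : ℕ) : ((n : K) : (v.adicCompletion K)) = (n : (v.adicCompletion K)) := by
  rw [← map_natCast (algebraMap K (v.adicCompletion K)) n]; rfl

/-- `‖n‖ = 1` in `K_v` for `n ∉ v`. [folklore] -/
theorem valuation_natCast_eq_one {n : ℕ} (hn : (n : 𝓞 K) ∉ v.asIdeal) :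
    (NormedField.valuation : Valuation (v.adicCompletion K) ℝ≥0) (n : (v.adicCompletion K)) = 1 := by
  have h := (NumberField.FinitePlace.norm_eq_one_iff_notMem K v (n : 𝓞 K)).mpr hn
  rw [NumberField.FinitePlace.embedding_apply, map_natCast, coe_natCast] at h
  rw [valuation_apply, ← NNReal.coe_inj, coe_nnnorm, NNReal.coe_one]
  exact h

/-- `‖p‖ < 1` in `K_v` for `p ∈ v`. [folklore] -/
theorem valuation_natCast_lt_one {p : ℕ} (hp : (p : 𝓞 K) ∈ v.asIdeal) :
    (NormedField.valuation : Valuation (v.adicCompletion K) ℝ≥0) (p : (v.adicCompletion K)) < 1 := by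
  have h := (NumberField.FinitePlace.norm_lt_one_iff_mem K v (p : 𝓞 K)).mpr hp
  rw [NumberField.FinitePlace.embedding_apply, map_natCast, coe_natCast] at h
  rw [valuation_apply, ← NNReal.coe_lt_coe, coe_nnnorm, NNReal.coe_one]
  exact h

/-- **The residue characteristic of `v`**: there is a prime `p` with `‖p‖ < 1` in `K_v` such that
every integer prime to `p` is a unit, `‖n‖ = 1` (`p` is the characteristic of the finite residue
field `𝓞_K/v`; `n` prime to `p` is prime to `v` by Bézout). These are the hypotheses `hunit`,
`ρ < |p|` of `FormalGroupDivision`. [folklore] -/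
theorem exists_residueChar :
    ∃ p : ℕ, p.Prime ∧
      (NormedField.valuation : Valuation (v.adicCompletion K) ℝ≥0) (p : (v.adicCompletion K)) < 1 ∧
      ∀ n : ℕ, ¬ p ∣ n →
        (NormedField.valuation : Valuation (v.adicCompletion K) ℝ≥0) (n : (v.adicCompletion K)) = 1 := by
  -- the characteristic of the residue field `𝓞_K / v` lies in `v`
  haveI : v.asIdeal.IsPrime := v.isPrime
  obtain ⟨p, hpchar⟩ := CharP.exists (𝓞 K ⧸ v.asIdeal)
  haveI : Fact (Nat.Prime p) := ⟨(CharP.char_is_prime_or_zero (𝓞 K ⧸ v.asIdeal) p).resolve_right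
    (CharP.char_ne_zero_of_finite (𝓞 K ⧸ v.asIdeal) p)⟩
  have hpv : (p : 𝓞 K) ∈ v.asIdeal := by
    rw [← Ideal.Quotient.eq_zero_iff_mem, map_natCast]
    exact CharP.cast_eq_zero _ p
  exact ⟨p, Fact.out, valuation_natCast_lt_one v hpv, fun n hn ↦
    valuation_natCast_eq_one v (HeightOneSpectrum.natCast_not_mem_asIdeal_of_prime_mem hpv hn)⟩

/-! ### Completeness: geometric Cauchy sequences converge, with the ultrametric error bound -/

/-- **Geometric Cauchy sequences of `K_v` converge with the expected error**: if
`‖x_{k+1} - x_k‖ ≤ C θᵏ` with `θ < 1` then some `y` has `‖y - x_k‖ ≤ C θᵏ` for all `k`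
(completeness of `K_v` and the ultrametric inequality `‖x_{k+m} - x_k‖ ≤ C θᵏ`). This is the
hypothesis `hcomplete` of `FormalGroupChart.exists_nsmul_eq_of_val_le_mul`. [folklore] -/
theorem exists_limit_of_geometric (x : ℕ → (v.adicCompletion K)) (C θ : ℝ≥0) (hθ : θ < 1)
    (hx : ∀ k, (NormedField.valuation : Valuation (v.adicCompletion K) ℝ≥0) (x (k + 1) - x k) ≤ C * θ ^ k) : ∃ y : (v.adicCompletion K), ∀ k, (NormedField.valuation : Valuation (v.adicCompletion K) ℝ≥0) (y - x k) ≤ C * θ ^ k := by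
  simp only [valuation_apply] at hx ⊢
  have htail : ∀ k m, ‖x (k + m) - x k‖₊ ≤ C * θ ^ k := by
    intro k m
    induction m with
    | zero => simp
    | succ m ih =>
      have e : x (k + (m + 1)) - x k = (x (k + m + 1) - x (k + m)) + (x (k + m) - x k) := by
        rw [← add_assoc]; abel
      rw [e]
      refine (IsUltrametricDist.nnnorm_add_le_max _ _).trans (max_le ?_ ih)
      calc ‖x (k + m + 1) - x (k + m)‖₊ ≤ C * θ ^ (k + m) := hx (k + m)
        _ ≤ C * θ ^ k :=
            mul_le_mul' le_rfl (pow_le_pow_right_of_le_one' hθ.le (Nat.le_add_right k m))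
  have hcs : CauchySeq x := by
    refine cauchySeq_of_le_geometric (θ : ℝ) C (by exact_mod_cast hθ) fun n ↦ ?_
    rw [dist_eq_norm, ← norm_neg, neg_sub]
    have h := hx n
    rw [← NNReal.coe_le_coe] at h
    push_cast at h
    exact h
  obtain ⟨y, hy⟩ := cauchySeq_tendsto_of_complete hcs
  refine ⟨y, fun k ↦ ?_⟩
  have hlim : Tendsto (fun m ↦ x (k + m)) atTop (𝓝 y) := by
    have h1 : Tendsto (fun m : ℕ ↦ k + m) atTop atTop := by
      simpa only [add_comm] using tendsto_add_atTop_nat k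
    exact hy.comp h1
  have hcont : Continuous fun a : (v.adicCompletion K) ↦ ‖a - x k‖₊ := by fun_prop
  have h := (hcont.tendsto y).comp hlim
  exact le_of_tendsto' h (fun m ↦ htail k m)

/-! ### Hensel: every small parameter is realised by a point of `E₁(K_v)` -/

/-- **`z : E₁(K_v) → 𝔪_v` is onto** (Silverman, *AEC*, Prop. VII.2.2: `E₁(K) ≅ Ê(𝓜)` for complete
`K`): for a Weierstrass equation `W₀` over `O_v` with `W₀ ⊗ K_v` elliptic and `‖a‖ < 1` there is
`P ∈ E₁(K_v)` with `z(P) = a`. Along `x = -a y` the equation is the cubic of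
`FormalGroupChart.equation_of_root`; its monic form `v³ + u v² + c v - d` (`u = 1 - a₁a - a₂a²` a
unit, `c, d ∈ a O_v`) reduces to `v²(v + ū)` and Hensel's lemma in the complete ring `O_v`
(`Literature/RingTheory/DiscreteValuationRing/AdicCompletionHensel`) lifts the simple root `-ū` to a
unit root `r`; then `y = r/a³`, `x = -a y` is a point with `|x| = |a|⁻² > 1` and `z = a`. This is
the hypothesis `hlift` of `FormalGroupChart.exists_nsmul_eq_of_val_le_mul` for `K_v`.
[cite: SilvermanAEC2009, Prop. VII.2.2] -/
theorem exists_mem_kernel_zCoord_eq (W₀ : WeierstrassCurve (v.adicCompletionIntegers K)) [hE : (W₀.baseChange (v.adicCompletion K)).IsElliptic]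
    [hV : (W₀.baseChange (v.adicCompletion K)).IsIntegral ((NormedField.valuation : Valuation (v.adicCompletion K) ℝ≥0)).integer] {a : (v.adicCompletion K)} (ha : (NormedField.valuation : Valuation (v.adicCompletion K) ℝ≥0) a < 1) :
    ∃ P ∈ kernel (NormedField.valuation : Valuation (v.adicCompletion K) ℝ≥0) (W₀.baseChange (v.adicCompletion K)), P.zCoord = a := by
  by_cases ha0 : a = 0
  · exact ⟨0, (kernel (NormedField.valuation : Valuation (v.adicCompletion K) ℝ≥0) (W₀.baseChange (v.adicCompletion K))).zero_mem,
      by rw [WeierstrassCurve.Affine.Point.zCoord_zero, ha0]⟩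
  have ha0' : 0 < (NormedField.valuation : Valuation (v.adicCompletion K) ℝ≥0) a := (Valuation.pos_iff _).mpr ha0
  have ha1 : (NormedField.valuation : Valuation (v.adicCompletion K) ℝ≥0) a ≤ 1 := ha.le
  -- `a` as an element of `O_v`, in the maximal ideal
  have hamem : a ∈ (v.adicCompletionIntegers K) := (norm_le_one_iff_mem v a).mp (by
    have h := ha1; rwa [valuation_apply, ← NNReal.coe_le_coe, coe_nnnorm, NNReal.coe_one] at h)
  set a₀ : (v.adicCompletionIntegers K) := ⟨a, hamem⟩ with ha₀def
  have ha₀ : (a₀ : (v.adicCompletion K)) = a := rfl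
  have ha₀m : a₀ ∈ IsLocalRing.maximalIdeal (v.adicCompletionIntegers K) := (mem_maximalIdeal_iff v a₀).mpr ha
  -- the coefficients of the monic cubic, in `O_v`
  set u₀ : (v.adicCompletionIntegers K) := 1 - W₀.a₁ * a₀ - W₀.a₂ * a₀ ^ 2 with hu₀
  set c₀ : (v.adicCompletionIntegers K) := (W₀.a₃ + W₀.a₄ * a₀) * a₀ ^ 3 with hc₀
  set d₀ : (v.adicCompletionIntegers K) := W₀.a₆ * a₀ ^ 6 with hd₀
  have hc₀m : c₀ ∈ IsLocalRing.maximalIdeal (v.adicCompletionIntegers K) := by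
    rw [hc₀, pow_succ, ← mul_assoc]
    exact Ideal.mul_mem_left _ _ ha₀m
  have hd₀m : d₀ ∈ IsLocalRing.maximalIdeal (v.adicCompletionIntegers K) := by
    rw [hd₀, pow_succ, ← mul_assoc]
    exact Ideal.mul_mem_left _ _ ha₀m
  have hu₀1 : u₀ - 1 ∈ IsLocalRing.maximalIdeal (v.adicCompletionIntegers K) := by
    have e : u₀ - 1 = -(W₀.a₁ + W₀.a₂ * a₀) * a₀ := by rw [hu₀]; ring
    rw [e]
    exact Ideal.mul_mem_left _ _ ha₀m
  -- a quantity `≡ 1 (mod 𝔪)` is a unit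
  have hunit_of : ∀ x : (v.adicCompletionIntegers K), x - 1 ∈ IsLocalRing.maximalIdeal (v.adicCompletionIntegers K) → IsUnit x := by
    intro x hx
    by_contra hxu
    have hxm : x ∈ IsLocalRing.maximalIdeal (v.adicCompletionIntegers K) := (IsLocalRing.mem_maximalIdeal _).mpr hxu
    have h1 : (1 : (v.adicCompletionIntegers K)) ∈ IsLocalRing.maximalIdeal (v.adicCompletionIntegers K) := by
      have e : (1 : (v.adicCompletionIntegers K)) = x - (x - 1) := by ring
      rw [e]; exact Ideal.sub_mem _ hxm hx
    exact (IsLocalRing.maximalIdeal.isMaximal (v.adicCompletionIntegers K)).ne_top ((Ideal.eq_top_iff_one _).mpr h1)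
  have hu₀unit : IsUnit u₀ := hunit_of u₀ hu₀1
  -- the monic cubic
  set f : (v.adicCompletionIntegers K)[X] := X ^ 3 + C u₀ * X ^ 2 + C c₀ * X - C d₀ with hf
  have hfmonic : f.Monic := by
    rw [hf, sub_eq_add_neg, add_assoc, add_assoc]
    refine (monic_X_pow 3).add_of_left ?_
    refine (degree_add_le _ _).trans_lt (max_lt ?_ ((degree_add_le _ _).trans_lt (max_lt ?_ ?_)))
    · exact (degree_C_mul_X_pow_le 2 _).trans_lt (by rw [degree_X_pow]; norm_num)
    · exact (degree_C_mul_X_le _).trans_lt (by rw [degree_X_pow]; norm_num)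
    · rw [degree_neg]; exact (degree_C_le).trans_lt (by rw [degree_X_pow]; norm_num)
  have hfeval : ∀ Y : (v.adicCompletionIntegers K), f.eval Y = Y ^ 3 + u₀ * Y ^ 2 + c₀ * Y - d₀ := by
    intro Y
    rw [hf]
    simp only [eval_add, eval_sub, eval_mul, eval_pow, eval_X, eval_C]
  have hfder : ∀ Y : (v.adicCompletionIntegers K), f.derivative.eval Y = 3 * Y ^ 2 + u₀ * (2 * Y) + c₀ := by
    intro Y
    rw [hf]
    simp only [derivative_add, derivative_sub, derivative_mul, derivative_X_pow, derivative_C,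
      derivative_X, zero_mul, zero_add, mul_one, sub_zero, eval_add, eval_mul, eval_pow, eval_X,
      eval_C]
    push_cast
    ring
  -- Hensel's hypotheses at `-u₀`
  have h₁ : f.eval (-u₀) ∈ IsLocalRing.maximalIdeal (v.adicCompletionIntegers K) := by
    rw [hfeval]
    have e : (-u₀) ^ 3 + u₀ * (-u₀) ^ 2 + c₀ * (-u₀) - d₀ = -(c₀ * u₀ + d₀) := by ring
    rw [e]
    exact neg_mem (Ideal.add_mem _ (Ideal.mul_mem_right _ _ hc₀m) hd₀m)
  have h₂ : IsUnit (f.derivative.eval (-u₀)) := by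
    rw [hfder]
    refine hunit_of _ ?_
    have e : 3 * (-u₀) ^ 2 + u₀ * (2 * -u₀) + c₀ - 1 = (u₀ - 1) * (u₀ + 1) + c₀ := by ring
    rw [e]
    exact Ideal.add_mem _ (Ideal.mul_mem_right _ _ hu₀1) hc₀m
  obtain ⟨r, hr, hru⟩ := HenselianLocalRing.is_henselian f hfmonic (-u₀) h₁ h₂
  -- the root is a unit (`r ≡ -u₀ ≡ -1 (mod 𝔪)`)
  have hrunit : IsUnit r := by
    rw [← IsUnit.neg_iff]
    refine hunit_of (-r) ?_
    have e : -r - 1 = -(r - -u₀) + (u₀ - 1) := by ring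
    rw [e]
    exact Ideal.add_mem _ (neg_mem hru) hu₀1
  have hrv : (NormedField.valuation : Valuation (v.adicCompletion K) ℝ≥0) (r : (v.adicCompletion K)) = 1 := (isUnit_iff_valuation_eq_one v r).mp hrunit
  -- the point `(-a y, y)`, `y = r / a³`
  have ha3 : a ^ 3 ≠ 0 := pow_ne_zero 3 ha0
  set y : (v.adicCompletion K) := (r : (v.adicCompletion K)) / a ^ 3 with hy
  have hya : y * a ^ 3 = (r : (v.adicCompletion K)) := by rw [hy, div_mul_cancel₀ _ ha3]
  have hwy : (NormedField.valuation : Valuation (v.adicCompletion K) ℝ≥0) y * (NormedField.valuation : Valuation (v.adicCompletion K) ℝ≥0) a ^ 3 = 1 := by rw [← map_pow, ← map_mul, hya, hrv]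
  have hy0 : y ≠ 0 := by
    intro h; rw [h, map_zero, zero_mul] at hwy; exact zero_ne_one hwy
  -- the root relation, pushed to `K_v` and rewritten in the coordinates of `W₀ ⊗ K_v`
  have hroot : (r : (v.adicCompletion K)) ^ 3 + ((u₀ : (v.adicCompletionIntegers K)) : (v.adicCompletion K)) * (r : (v.adicCompletion K)) ^ 2 + ((c₀ : (v.adicCompletionIntegers K)) : (v.adicCompletion K)) * r - ((d₀ : (v.adicCompletionIntegers K)) : (v.adicCompletion K)) = 0 := by
    have h : f.eval r = 0 := hr
    rw [hfeval] at h
    have h' := congrArg ((↑) : (v.adicCompletionIntegers K) → (v.adicCompletion K)) h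
    push_cast at h'
    exact h'
  have hu : ((u₀ : (v.adicCompletionIntegers K)) : (v.adicCompletion K)) = 1 - (W₀.baseChange (v.adicCompletion K)).a₁ * a - (W₀.baseChange (v.adicCompletion K)).a₂ * a ^ 2 := by
    rw [hu₀]; push_cast; rw [ha₀]; rfl
  have hc : ((c₀ : (v.adicCompletionIntegers K)) : (v.adicCompletion K)) = ((W₀.baseChange (v.adicCompletion K)).a₃ + (W₀.baseChange (v.adicCompletion K)).a₄ * a) * a ^ 3 := by
    rw [hc₀]; push_cast; rw [ha₀]; rfl
  have hd : ((d₀ : (v.adicCompletionIntegers K)) : (v.adicCompletion K)) = (W₀.baseChange (v.adicCompletion K)).a₆ * a ^ 6 := by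
    rw [hd₀]; push_cast; rw [ha₀]; rfl
  rw [← hya, hu, hc, hd] at hroot
  have hg6 : a ^ 6 * (a ^ 3 * y ^ 3 + (1 - (W₀.baseChange (v.adicCompletion K)).a₁ * a - (W₀.baseChange (v.adicCompletion K)).a₂ * a ^ 2) * y ^ 2
      + ((W₀.baseChange (v.adicCompletion K)).a₃ + (W₀.baseChange (v.adicCompletion K)).a₄ * a) * y - (W₀.baseChange (v.adicCompletion K)).a₆) = 0 := by
    rw [← monic_cubic_eval]
    linear_combination hroot
  have hg := (mul_eq_zero.mp hg6).resolve_left (pow_ne_zero 6 ha0)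
  have heq : (W₀.baseChange (v.adicCompletion K)).toAffine.Equation (-a * y) y := equation_of_root hg
  have hns : (W₀.baseChange (v.adicCompletion K)).toAffine.Nonsingular (-a * y) y :=
    WeierstrassCurve.Affine.equation_iff_nonsingular.mp heq
  refine ⟨.some (-a * y) y hns, some_mem_kernel hns (one_lt_val_of_root ha0' ha hwy), ?_⟩
  rw [WeierstrassCurve.Affine.Point.zCoord_some, neg_mul, neg_neg, mul_div_cancel_right₀ _ hy0]

/-- The `hlift` hypothesis of `FormalGroupDivision` for `K_v`: every `a` with `‖a‖ ≤ ρ < 1` is a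
parameter. [cite: SilvermanAEC2009, Prop. VII.2.2] -/
theorem hlift (W₀ : WeierstrassCurve (v.adicCompletionIntegers K)) [(W₀.baseChange (v.adicCompletion K)).IsElliptic]
    [(W₀.baseChange (v.adicCompletion K)).IsIntegral ((NormedField.valuation : Valuation (v.adicCompletion K) ℝ≥0)).integer] {ρ : ℝ≥0} (hρ : ρ < 1) :
    ∀ a : (v.adicCompletion K), (NormedField.valuation : Valuation (v.adicCompletion K) ℝ≥0) a ≤ ρ → ∃ P ∈ kernel (NormedField.valuation : Valuation (v.adicCompletion K) ℝ≥0) (W₀.baseChange (v.adicCompletion K)), P.zCoord = a :=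
  fun _ ha ↦ exists_mem_kernel_zCoord_eq v W₀ (ha.trans_lt hρ)

/-! ### Balls of `K_v`: `[B_{|c|} : B_{|n||c|}] = (O_v : n O_v)`, finite -/

/-- `O_v / c O_v` is finite for `c ≠ 0` (`c O_v = 𝔪ᵏ` in the discrete valuation ring `O_v`, whose
residue field is finite; Mathlib `Ideal.finite_quotient_pow`). [folklore] -/
theorem finite_quotient_span_singleton {c : (v.adicCompletionIntegers K)} (hc : c ≠ 0) : Finite ((v.adicCompletionIntegers K) ⧸ Ideal.span {c}) := by
  haveI : Finite ((v.adicCompletionIntegers K) ⧸ IsLocalRing.maximalIdeal (v.adicCompletionIntegers K)) :=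
    inferInstanceAs (Finite (IsLocalRing.ResidueField (v.adicCompletionIntegers K)))
  obtain ⟨π, hπ⟩ := IsDiscreteValuationRing.exists_irreducible (v.adicCompletionIntegers K)
  have hs : Ideal.span {c} ≠ ⊥ := by rwa [Ne, Ideal.span_singleton_eq_bot]
  obtain ⟨k, hk⟩ := IsDiscreteValuationRing.ideal_eq_span_pow_irreducible hs hπ
  rw [hk, ← Ideal.span_singleton_pow, ← hπ.maximalIdeal_eq]
  exact Ideal.finite_quotient_pow (IsNoetherian.noetherian _) k

/-- `(n : O_v) ≠ 0` for `n ≠ 0`. [folklore] -/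
theorem natCast_ne_zero {n : ℕ} (hn : n ≠ 0) : (n : (v.adicCompletionIntegers K)) ≠ 0 := by
  haveI : CharZero (v.adicCompletion K) := charZero_of_injective_algebraMap (algebraMap K _).injective
  intro h
  have h' := congrArg ((↑) : (v.adicCompletionIntegers K) → (v.adicCompletion K)) h
  push_cast at h'
  exact hn (Nat.cast_eq_zero.mp h')

/-- **`n O_v = {a ∈ O_v : ‖a‖ ≤ ‖n‖}`**: divisibility in the valuation ring `O_v` is comparison of
absolute values. [folklore] -/
theorem mem_span_natCast_iff {n : ℕ} (hn : n ≠ 0) (a : (v.adicCompletionIntegers K)) :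
    a ∈ Ideal.span {(n : (v.adicCompletionIntegers K))} ↔ (NormedField.valuation : Valuation (v.adicCompletion K) ℝ≥0) (a : (v.adicCompletion K)) ≤ (NormedField.valuation : Valuation (v.adicCompletion K) ℝ≥0) (n : (v.adicCompletion K)) := by
  haveI : CharZero (v.adicCompletion K) := charZero_of_injective_algebraMap (algebraMap K _).injective
  have hn0 : (n : (v.adicCompletion K)) ≠ 0 := Nat.cast_ne_zero.mpr hn
  rw [Ideal.mem_span_singleton]
  constructor
  · rintro ⟨b, rfl⟩
    push_cast
    rw [map_mul]
    exact mul_le_of_le_one_right' (valuation_coe_le_one v b)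
  · intro h
    have hb1 : (NormedField.valuation : Valuation (v.adicCompletion K) ℝ≥0) ((a : (v.adicCompletion K)) / n) ≤ 1 := by
      rw [map_div₀]; exact div_le_one_of_le₀ h zero_le
    have hbmem : (a : (v.adicCompletion K)) / n ∈ (v.adicCompletionIntegers K) := (norm_le_one_iff_mem v _).mp (by
      rwa [valuation_apply, ← NNReal.coe_le_coe, coe_nnnorm, NNReal.coe_one] at hb1)
    refine ⟨⟨(a : (v.adicCompletion K)) / n, hbmem⟩, Subtype.ext ?_⟩
    push_cast
    rw [mul_div_cancel₀ _ hn0]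

/-- **`[B_{‖c‖} : B_{‖n‖ ‖c‖}] = (O_v : n O_v)`** for `c ≠ 0`, `n ≠ 0`, where
`B_t = {a ∈ K_v : ‖a‖ ≤ t}` (Mathlib `Valuation.leAddSubgroup`): multiplication by `c` is an
additive isomorphism `O_v ≅ B_{‖c‖}` carrying `n O_v` onto `B_{‖n‖ ‖c‖}`
(`AddSubgroup.relIndex_comap`). (Levels are taken as variables `t = ‖c‖`, `s = ‖n‖ ‖c‖` so that
the statement can be used at syntactically different presentations of the same level.) [folklore] -/
theorem relIndex_leAddSubgroup_eq {c : (v.adicCompletion K)} (hc : c ≠ 0) {n : ℕ} (hn : n ≠ 0) {s t : ℝ≥0}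
    (ht : t = (NormedField.valuation : Valuation (v.adicCompletion K) ℝ≥0) c) (hs : s = (NormedField.valuation : Valuation (v.adicCompletion K) ℝ≥0) (n : (v.adicCompletion K)) * (NormedField.valuation : Valuation (v.adicCompletion K) ℝ≥0) c) :
    (((NormedField.valuation : Valuation (v.adicCompletion K) ℝ≥0)).leAddSubgroup s).relIndex (((NormedField.valuation : Valuation (v.adicCompletion K) ℝ≥0)).leAddSubgroup t) = Nat.card ((v.adicCompletionIntegers K) ⧸ Ideal.span {(n : (v.adicCompletionIntegers K))}) := by
  subst ht hs
  have hc0 : 0 < (NormedField.valuation : Valuation (v.adicCompletion K) ℝ≥0) c := (Valuation.pos_iff _).mpr hc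
  -- `e : O_v → K_v`, `a ↦ c a`
  let e : (v.adicCompletionIntegers K) →+ (v.adicCompletion K) :=
    { toFun := fun a ↦ c * a
      map_zero' := by rw [ZeroMemClass.coe_zero, mul_zero]
      map_add' := fun a b ↦ by rw [AddMemClass.coe_add, mul_add] }
  have he : ∀ a : (v.adicCompletionIntegers K), e a = c * a := fun _ ↦ rfl
  have hrange : e.range = ((NormedField.valuation : Valuation (v.adicCompletion K) ℝ≥0)).leAddSubgroup ((NormedField.valuation : Valuation (v.adicCompletion K) ℝ≥0) c) := by
    ext b
    simp only [AddMonoidHom.mem_range, Valuation.mem_leAddSubgroup_iff, he]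
    constructor
    · rintro ⟨a, rfl⟩
      rw [map_mul]
      exact mul_le_of_le_one_right' (valuation_coe_le_one v a)
    · intro hb
      have hb1 : (NormedField.valuation : Valuation (v.adicCompletion K) ℝ≥0) (b / c) ≤ 1 := by
        rw [map_div₀]; exact div_le_one_of_le₀ hb zero_le
      have hbmem : b / c ∈ (v.adicCompletionIntegers K) := (norm_le_one_iff_mem v _).mp (by
        rwa [valuation_apply, ← NNReal.coe_le_coe, coe_nnnorm, NNReal.coe_one] at hb1)
      exact ⟨⟨b / c, hbmem⟩, by rw [Subtype.coe_mk, mul_div_cancel₀ _ hc]⟩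
  have hcomap : (((NormedField.valuation : Valuation (v.adicCompletion K) ℝ≥0)).leAddSubgroup ((NormedField.valuation : Valuation (v.adicCompletion K) ℝ≥0) (n : (v.adicCompletion K)) * (NormedField.valuation : Valuation (v.adicCompletion K) ℝ≥0) c)).comap e =
      (Ideal.span {(n : (v.adicCompletionIntegers K))}).toAddSubgroup := by
    ext a
    rw [AddSubgroup.mem_comap, Valuation.mem_leAddSubgroup_iff, he, map_mul, mul_comm ((NormedField.valuation : Valuation (v.adicCompletion K) ℝ≥0) c),
      Submodule.mem_toAddSubgroup, mem_span_natCast_iff v hn a]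
    exact ⟨fun h ↦ le_of_mul_le_mul_right h hc0, fun h ↦ mul_le_mul_of_nonneg_right h zero_le⟩
  calc (((NormedField.valuation : Valuation (v.adicCompletion K) ℝ≥0)).leAddSubgroup ((NormedField.valuation : Valuation (v.adicCompletion K) ℝ≥0) (n : (v.adicCompletion K)) * (NormedField.valuation : Valuation (v.adicCompletion K) ℝ≥0) c)).relIndex (((NormedField.valuation : Valuation (v.adicCompletion K) ℝ≥0)).leAddSubgroup ((NormedField.valuation : Valuation (v.adicCompletion K) ℝ≥0) c))
      = (((NormedField.valuation : Valuation (v.adicCompletion K) ℝ≥0)).leAddSubgroup ((NormedField.valuation : Valuation (v.adicCompletion K) ℝ≥0) (n : (v.adicCompletion K)) * (NormedField.valuation : Valuation (v.adicCompletion K) ℝ≥0) c)).relIndex ((⊤ : AddSubgroup (v.adicCompletionIntegers K)).map e) := by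
        rw [← AddMonoidHom.range_eq_map, hrange]
    _ = ((((NormedField.valuation : Valuation (v.adicCompletion K) ℝ≥0)).leAddSubgroup ((NormedField.valuation : Valuation (v.adicCompletion K) ℝ≥0) (n : (v.adicCompletion K)) * (NormedField.valuation : Valuation (v.adicCompletion K) ℝ≥0) c)).comap e).relIndex ⊤ :=
        (AddSubgroup.relIndex_comap _ e ⊤).symm
    _ = (Ideal.span {(n : (v.adicCompletionIntegers K))}).toAddSubgroup.index := by
        rw [AddSubgroup.relIndex_top_right, hcomap]
    _ = Nat.card ((v.adicCompletionIntegers K) ⧸ Ideal.span {(n : (v.adicCompletionIntegers K))}) := rfl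

/-- `(O_v : n O_v) ≠ 0` (the quotient is finite) for `n ≠ 0`. [folklore] -/
theorem card_quotient_span_natCast_ne_zero {n : ℕ} (hn : n ≠ 0) :
    Nat.card ((v.adicCompletionIntegers K) ⧸ Ideal.span {(n : (v.adicCompletionIntegers K))}) ≠ 0 := by
  haveI := finite_quotient_span_singleton v (natCast_ne_zero v hn)
  exact Nat.card_pos.ne'

/-- The quotients `B_t / B_s` of balls of `K_v`, `t = ‖c‖`, `s = ‖n‖ ‖c‖` (`c ≠ 0`, `n ≠ 0`), are
finite. [folklore] -/
theorem finite_quotient_leAddSubgroup {c : (v.adicCompletion K)} (hc : c ≠ 0) {n : ℕ} (hn : n ≠ 0) {s t : ℝ≥0}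
    (ht : t = (NormedField.valuation : Valuation (v.adicCompletion K) ℝ≥0) c) (hs : s = (NormedField.valuation : Valuation (v.adicCompletion K) ℝ≥0) (n : (v.adicCompletion K)) * (NormedField.valuation : Valuation (v.adicCompletion K) ℝ≥0) c) :
    Finite ((((NormedField.valuation : Valuation (v.adicCompletion K) ℝ≥0)).leAddSubgroup t) ⧸ (((NormedField.valuation : Valuation (v.adicCompletion K) ℝ≥0)).leAddSubgroup s).addSubgroupOf (((NormedField.valuation : Valuation (v.adicCompletion K) ℝ≥0)).leAddSubgroup t)) := by
  have h := relIndex_leAddSubgroup_eq v hc hn ht hs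
  haveI : ((((NormedField.valuation : Valuation (v.adicCompletion K) ℝ≥0)).leAddSubgroup s).addSubgroupOf (((NormedField.valuation : Valuation (v.adicCompletion K) ℝ≥0)).leAddSubgroup t)).FiniteIndex :=
    ⟨by rw [← AddSubgroup.relIndex, h]; exact card_quotient_span_natCast_ne_zero v hn⟩
  exact AddSubgroup.finite_quotient_of_finiteIndex

/-! ### Herbrand quotient of multiplication by `n` along a finite-index torsion-free subgroup -/

section Herbrand

variable {G : Type*} [AddCommGroup G]

omit [NumberField K] in
/-- **`[G : nG] = [A : nA] · #G[n]`** for a subgroup `A ≤ G` of finite index without `n`-torsion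
(`n G`, `G[n]` the range and kernel of `nsmulAddMonoidHom n`): the Herbrand-quotient identity
`[G : nA] = [G : A + G[n]] [G : nG] = [G : A] [A : nA]`, `[G : A] = [G : A + G[n]] [G[n] : A ∩ G[n]]`
with `A ∩ G[n] = 0`. (The general identity with `#(A ∩ G[n])` is `index_range_zsmul_mul_card` of
`BhargavaShankarCountingProofs`, stated there for `zsmulAddGroupHom`; the present torsion-free
`ℕ`-form is what Milne's count uses.) [cite: MilneADT2006, I Lemma 3.3] -/
theorem index_range_nsmul_eq (A : AddSubgroup G) [A.FiniteIndex] (n : ℕ)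
    (hA : ∀ a ∈ A, n • a = 0 → a = 0) :
    (nsmulAddMonoidHom n : G →+ G).range.index =
      (A.map (nsmulAddMonoidHom n : G →+ G)).relIndex A *
        Nat.card (nsmulAddMonoidHom n : G →+ G).ker := by
  set f := (nsmulAddMonoidHom n : G →+ G) with hf
  have hle1 : A.map f ≤ A := by
    rintro _ ⟨a, ha, rfl⟩
    exact A.nsmul_mem ha n
  have hle2 : A ≤ A ⊔ f.ker := le_sup_left
  have h1 : (A.map f).index = (A ⊔ f.ker).index * f.range.index := A.index_map f
  have h2 : (A.map f).relIndex A * A.index = (A.map f).index := AddSubgroup.relIndex_mul_index hle1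
  have h3 : A.relIndex (A ⊔ f.ker) * (A ⊔ f.ker).index = A.index :=
    AddSubgroup.relIndex_mul_index hle2
  have h4 : A.relIndex (A ⊔ f.ker) = A.relIndex f.ker := AddSubgroup.relIndex_sup_left _ _
  have h5 : Nat.card (A.addSubgroupOf f.ker) * A.relIndex f.ker = Nat.card f.ker :=
    AddSubgroup.card_mul_index _
  have hbot : A.addSubgroupOf f.ker = ⊥ := by
    rw [eq_bot_iff]
    rintro ⟨x, hx⟩ hxA
    rw [AddSubgroup.mem_bot]
    apply Subtype.ext
    rw [AddMonoidHom.mem_ker, hf, nsmulAddMonoidHom_apply] at hx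
    exact hA x hxA hx
  have h6 : Nat.card (A.addSubgroupOf f.ker) = 1 := by
    rw [hbot]; exact AddSubgroup.card_bot
  haveI : (A ⊔ f.ker).FiniteIndex := AddSubgroup.finiteIndex_of_le hle2
  have hs : (A ⊔ f.ker).index ≠ 0 := AddSubgroup.FiniteIndex.index_ne_zero
  have key : (A.map f).relIndex A * A.relIndex f.ker = f.range.index := by
    apply Nat.eq_of_mul_eq_mul_left (Nat.pos_of_ne_zero hs)
    calc (A ⊔ f.ker).index * ((A.map f).relIndex A * A.relIndex f.ker)
        = (A.map f).relIndex A * (A.relIndex (A ⊔ f.ker) * (A ⊔ f.ker).index) := by rw [h4]; ring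
      _ = (A.map f).relIndex A * A.index := by rw [h3]
      _ = (A ⊔ f.ker).index * f.range.index := by rw [h2, h1]
  rw [← key, ← h5, h6, one_mul]

omit [NumberField K] in
/-- **`G[n]` is finite** when `G` has a finite-index subgroup `A` without `n`-torsion: `G[n]`
injects into `G/A`. [cite: MilneADT2006, I Lemma 3.3] -/
theorem finite_ker_nsmul (A : AddSubgroup G) [A.FiniteIndex] (n : ℕ)
    (hA : ∀ a ∈ A, n • a = 0 → a = 0) : Finite (nsmulAddMonoidHom n : G →+ G).ker := by
  haveI : Finite (G ⧸ A) := AddSubgroup.finite_quotient_of_finiteIndex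
  refine Finite.of_injective (fun x : (nsmulAddMonoidHom n : G →+ G).ker ↦ ((x : G) : G ⧸ A)) ?_
  rintro ⟨x, hx⟩ ⟨y, hy⟩ hxy
  apply Subtype.ext
  have hmem : -x + y ∈ A := QuotientAddGroup.eq.mp hxy
  rw [AddMonoidHom.mem_ker, nsmulAddMonoidHom_apply] at hx hy
  have h0 : n • (-x + y) = 0 := by rw [nsmul_add, neg_nsmul, hx, hy, neg_zero, add_zero]
  have h := hA _ hmem h0
  rwa [neg_add_eq_zero] at h

omit [NumberField K] in
/-- Transport of the package "finite-index, torsion-free subgroup `U` with prescribed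
`[U : n U]`" along an additive isomorphism. [folklore] -/
theorem transfer {H : Type*} [AddCommGroup H] (e : G ≃+ H) {N : ℕ → ℕ}
    (h : ∃ U : AddSubgroup H, U.FiniteIndex ∧ (∀ n : ℕ, n ≠ 0 → ∀ P ∈ U, n • P = 0 → P = 0) ∧
      ∀ n : ℕ, n ≠ 0 → (U.map (nsmulAddMonoidHom n : H →+ H)).relIndex U = N n) :
    ∃ U : AddSubgroup G, U.FiniteIndex ∧ (∀ n : ℕ, n ≠ 0 → ∀ P ∈ U, n • P = 0 → P = 0) ∧
      ∀ n : ℕ, n ≠ 0 → (U.map (nsmulAddMonoidHom n : G →+ G)).relIndex U = N n := by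
  obtain ⟨U, hU, htf, hidx⟩ := h
  refine ⟨U.comap e.toAddMonoidHom, ?_, ?_, ?_⟩
  · haveI := hU
    have hi : (U.comap e.toAddMonoidHom).index = U.index :=
      AddSubgroup.index_comap_of_surjective U e.surjective
    exact ⟨by rw [hi]; exact AddSubgroup.FiniteIndex.index_ne_zero⟩
  · intro n hn P hP h0
    have h1 : n • e P = 0 := by rw [← map_nsmul, h0, map_zero]
    have h2 := htf n hn (e P) hP h1
    exact e.map_eq_zero_iff.mp h2
  · intro n hn
    rw [← hidx n hn]
    have hmap : (U.comap e.toAddMonoidHom).map (nsmulAddMonoidHom n : G →+ G) =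
        (U.map (nsmulAddMonoidHom n : H →+ H)).comap e.toAddMonoidHom := by
      ext x
      simp only [AddSubgroup.mem_map, AddSubgroup.mem_comap, nsmulAddMonoidHom_apply,
        AddEquiv.coe_toAddMonoidHom]
      constructor
      · rintro ⟨y, hy, rfl⟩
        exact ⟨e y, hy, by rw [map_nsmul]⟩
      · rintro ⟨y, hy, hyx⟩
        refine ⟨e.symm y, by rwa [e.apply_symm_apply], e.injective ?_⟩
        rw [map_nsmul, e.apply_symm_apply, hyx]
    rw [hmap, AddSubgroup.relIndex_comap, AddSubgroup.map_comap_eq_self_of_surjective e.surjective]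

end Herbrand

/-! ### The subgroup `U = U_{‖p‖²}` of `E(K_v)` for an `O_v`-integral equation -/

/-- **Silverman, *AEC* VII.6.3 / Milne, *ADT* I Lemma 3.3, for an `O_v`-model.** Let `W₀` be a
Weierstrass equation over `O_v` with `W₀ ⊗ K_v` elliptic, `p` the residue characteristic of `v`.
Then the level `U = U_{‖p‖²} = {P ∈ E₁(K_v) : ‖z(P)‖ ≤ ‖p‖²}` of the kernel of reduction is a
subgroup of **finite index** in `E(K_v) = (W₀ ⊗ K_v)(K_v)` (`[E(K_v) : E₁(K_v)] < ∞` by the tree's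
`WeierstrassCurve.index_ne_zero_of_forall_some_mem`, `[E₁ : U] = [𝔪_v : p² O_v]`-type finiteness by
`relIndex_kernelLevel_ne_zero`), **torsion-free** (`eq_zero_of_nsmul_eq_zero`), with
**`[U : n U] = (O_v : n O_v)` for every `n ≠ 0`** (`relIndex_map_nsmul_kernelLevel_eq` with the
Hensel lift `hlift` and the completeness `exists_limit_of_geometric`, and
`relIndex_leAddSubgroup_eq`). [cite: SilvermanAEC2009, Prop. VII.6.3] [cite: MilneADT2006, I Lemma 3.3] -/
theorem exists_subgroup_baseChange (W₀ : WeierstrassCurve (v.adicCompletionIntegers K)) [hE : (W₀.baseChange (v.adicCompletion K)).IsElliptic] :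
    ∃ U : AddSubgroup (W₀.baseChange (v.adicCompletion K)).toAffine.Point,
      U.FiniteIndex ∧ (∀ n : ℕ, n ≠ 0 → ∀ P ∈ U, n • P = 0 → P = 0) ∧
      ∀ n : ℕ, n ≠ 0 → (U.map (nsmulAddMonoidHom n : _ →+ _)).relIndex U =
        Nat.card ((v.adicCompletionIntegers K) ⧸ Ideal.span {(n : (v.adicCompletionIntegers K))}) := by
  haveI hV := isIntegral_baseChange v W₀
  haveI : CharZero (v.adicCompletion K) := charZero_of_injective_algebraMap (algebraMap K _).injective
  -- `Δ(W₀) ≠ 0`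
  have hΔ : W₀.Δ ≠ 0 := by
    intro h0
    apply (W₀.baseChange (v.adicCompletion K)).isUnit_Δ.ne_zero
    rw [WeierstrassCurve.baseChange, WeierstrassCurve.map_Δ, h0, map_zero]
  -- the residue characteristic and the level `r = ‖p‖²`
  obtain ⟨p, hp, hp1, hunit⟩ := exists_residueChar v
  have hp0 : (p : (v.adicCompletion K)) ≠ 0 := Nat.cast_ne_zero.mpr hp.ne_zero
  have hp0' : 0 < (NormedField.valuation : Valuation (v.adicCompletion K) ℝ≥0) (p : (v.adicCompletion K)) := (Valuation.pos_iff _).mpr hp0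
  have hc : (p : (v.adicCompletion K)) ^ 2 ≠ 0 := pow_ne_zero 2 hp0
  have hr : (NormedField.valuation : Valuation (v.adicCompletion K) ℝ≥0) ((p : (v.adicCompletion K)) ^ 2) = (NormedField.valuation : Valuation (v.adicCompletion K) ℝ≥0) (p : (v.adicCompletion K)) * (NormedField.valuation : Valuation (v.adicCompletion K) ℝ≥0) (p : (v.adicCompletion K)) := by rw [map_pow, sq]
  have hrp : (NormedField.valuation : Valuation (v.adicCompletion K) ℝ≥0) ((p : (v.adicCompletion K)) ^ 2) < (NormedField.valuation : Valuation (v.adicCompletion K) ℝ≥0) (p : (v.adicCompletion K)) := by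
    rw [hr]; exact mul_lt_of_lt_one_left hp0' hp1
  have hr1 : (NormedField.valuation : Valuation (v.adicCompletion K) ℝ≥0) ((p : (v.adicCompletion K)) ^ 2) < 1 := hrp.trans hp1
  refine ⟨kernelLevel (NormedField.valuation : Valuation (v.adicCompletion K) ℝ≥0) (W₀.baseChange (v.adicCompletion K)) ((NormedField.valuation : Valuation (v.adicCompletion K) ℝ≥0) ((p : (v.adicCompletion K)) ^ 2)), ?_, ?_, ?_⟩
  · -- finite index
    have hker : (kernel (NormedField.valuation : Valuation (v.adicCompletion K) ℝ≥0) (W₀.baseChange (v.adicCompletion K))).index ≠ 0 := by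
      refine WeierstrassCurve.index_ne_zero_of_forall_some_mem W₀ hΔ _ fun x y h hx ↦
        some_mem_kernel h ?_
      by_contra hle
      rw [not_lt] at hle
      apply hx
      have hxmem : x ∈ (v.adicCompletionIntegers K) := (norm_le_one_iff_mem v x).mp (by
        rwa [valuation_apply, ← NNReal.coe_le_coe, coe_nnnorm, NNReal.coe_one] at hle)
      exact ⟨⟨x, hxmem⟩, rfl⟩
    have hrel : (kernelLevel (NormedField.valuation : Valuation (v.adicCompletion K) ℝ≥0) (W₀.baseChange (v.adicCompletion K)) ((NormedField.valuation : Valuation (v.adicCompletion K) ℝ≥0) ((p : (v.adicCompletion K)) ^ 2))).relIndex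
        (kernel (NormedField.valuation : Valuation (v.adicCompletion K) ℝ≥0) (W₀.baseChange (v.adicCompletion K))) ≠ 0 := by
      haveI := finite_quotient_leAddSubgroup v (one_ne_zero (α := (v.adicCompletion K))) (n := p ^ 2)
        (pow_ne_zero 2 hp.ne_zero) (t := (NormedField.valuation : Valuation (v.adicCompletion K) ℝ≥0) (1 : (v.adicCompletion K))) (s := (NormedField.valuation : Valuation (v.adicCompletion K) ℝ≥0) ((p : (v.adicCompletion K)) ^ 2)) rfl
        (by rw [map_one, mul_one, Nat.cast_pow])
      exact relIndex_kernelLevel_ne_zero (H := kernel (NormedField.valuation : Valuation (v.adicCompletion K) ℝ≥0) (W₀.baseChange (v.adicCompletion K))) le_rfl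
        (t := (NormedField.valuation : Valuation (v.adicCompletion K) ℝ≥0) (1 : (v.adicCompletion K))) (fun P hP ↦ by rw [map_one]; exact (val_zCoord_lt_one hP).le) _
    have hidx := AddSubgroup.relIndex_mul_index
      (kernelLevel_le_kernel (w := (NormedField.valuation : Valuation (v.adicCompletion K) ℝ≥0)) (V := W₀.baseChange (v.adicCompletion K)) ((NormedField.valuation : Valuation (v.adicCompletion K) ℝ≥0) ((p : (v.adicCompletion K)) ^ 2)))
    exact ⟨by rw [← hidx]; exact mul_ne_zero hrel hker⟩
  · -- torsion-free
    intro n hn P hP h0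
    exact eq_zero_of_nsmul_eq_zero hp hunit hn hP.1 (hP.2.trans_lt hrp) h0
  · -- the index of `n U`
    intro n hn
    rw [relIndex_map_nsmul_kernelLevel_eq hp hunit (exists_limit_of_geometric v) hn hrp
      (hlift v W₀ hr1)]
    exact relIndex_leAddSubgroup_eq v hc hn rfl rfl

end LocalPoints

/-! ### The theorems for an elliptic curve over a number field -/

section NumberField

variable {K : Type u} [Field K] [NumberField K] (v : HeightOneSpectrum (𝓞 K))


open LocalPoints in
/-- **Silverman, *AEC* Prop. VII.6.3 at a completion of a number field** ("Let `K` be a finite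
extension of `ℚ_p` […]. Then `E(K)` contains a subgroup of finite index that is isomorphic to
`R⁺`"), in the form in which Milne, *ADT* I Lemma 3.3 uses it ("`A(K)` contains an open subgroup
of finite index isomorphic to `R^{dim A}`; therefore […] `[A(K)⁽ⁿ⁾]/[A(K)ₙ] = (R : nR)^{dim A}`"):
for an elliptic curve `W` over a number field `K` and a finite place `v`, the group
`E(K_v) = (W ⊗ K_v)(K_v)` has a subgroup `U` of **finite index**, **torsion-free**, with
**`[U : n U] = (O_v : n O_v)`** for every `n ≠ 0` (the two properties of `R⁺` that the count uses).
Proof: scale `W ⊗ K_v` to an `O_v`-integral equation (Mathlib `exists_isIntegral`, the tree's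
`VariableChange.pointEquiv`) and apply `LocalPoints.exists_subgroup_baseChange`.
[cite: SilvermanAEC2009, Prop. VII.6.3] [cite: MilneADT2006, I Lemma 3.3] -/
theorem _root_.WeierstrassCurve.exists_finiteIndex_torsionFree_adicCompletion
    (W : WeierstrassCurve K) [W.IsElliptic] :
    ∃ U : AddSubgroup (W.baseChange (v.adicCompletion K)).toAffine.Point,
      U.FiniteIndex ∧ (∀ n : ℕ, n ≠ 0 → ∀ P ∈ U, n • P = 0 → P = 0) ∧
      ∀ n : ℕ, n ≠ 0 → (U.map (nsmulAddMonoidHom n : _ →+ _)).relIndex U =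
        Nat.card (v.adicCompletionIntegers K ⧸
          Ideal.span {(n : v.adicCompletionIntegers K)}) := by
  haveI : (W.baseChange (v.adicCompletion K)).IsElliptic := by
    rw [WeierstrassCurve.baseChange]; infer_instance
  obtain ⟨C, hC⟩ := WeierstrassCurve.exists_isIntegral (v.adicCompletionIntegers K) (W.baseChange (v.adicCompletion K))
  obtain ⟨W₀, hW₀⟩ := hC.integral
  haveI : (W₀.baseChange (v.adicCompletion K)).IsElliptic := by rw [← hW₀]; infer_instance
  have h := exists_subgroup_baseChange v W₀
  rw [← hW₀] at h
  exact transfer (VariableChange.pointEquiv (W.baseChange (v.adicCompletion K)) C) h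

open LocalPoints in
/-- **Milne, *ADT* I Lemma 3.3, the count `[A(K)⁽ⁿ⁾]/[A(K)ₙ] = (R : nR)^{dim A}` for an elliptic
curve at a completion of a number field**: for `n ≠ 0`,
`#(E(K_v)/n E(K_v)) = #E(K_v)[n] · #(O_v/n O_v)`, all three groups being finite
(`finite_quotient_range_nsmul_adicCompletion`, `finite_ker_nsmul_adicCompletion`,
`LocalPoints.finite_quotient_span_singleton`); `n E(K_v)` and `E(K_v)[n]` are the range and the
kernel of `nsmulAddMonoidHom n`. With the local Euler characteristic `χ(K_v, E[n]) = (O_v : n O_v)⁻²`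
this is the order computation behind Tate local duality for `E` (Milne I Thm. 3.2, Cor. 3.4:
`#H¹(K_v, E)[n] = #E(K_v)/n`), i.e. behind the maximality of the local Kummer images used in
Milne I Lemma 6.15 (Cassels–Tate pairing). [cite: MilneADT2006, I Lemma 3.3] [cite: SilvermanAEC2009, Prop. VII.6.3] -/
theorem _root_.WeierstrassCurve.card_quotient_range_nsmul_adicCompletion
    (W : WeierstrassCurve K) [W.IsElliptic] {n : ℕ} (hn : n ≠ 0) :
    Nat.card ((W.baseChange (v.adicCompletion K)).toAffine.Point ⧸
        (nsmulAddMonoidHom n : (W.baseChange (v.adicCompletion K)).toAffine.Point →+ _).range) =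
      Nat.card (nsmulAddMonoidHom n : (W.baseChange (v.adicCompletion K)).toAffine.Point →+ _).ker *
        Nat.card (v.adicCompletionIntegers K ⧸
          Ideal.span {(n : v.adicCompletionIntegers K)}) := by
  obtain ⟨U, hU, htf, hidx⟩ := W.exists_finiteIndex_torsionFree_adicCompletion v
  haveI := hU
  have h := index_range_nsmul_eq U n (htf n hn)
  rw [hidx n hn, AddSubgroup.index] at h
  rw [h, mul_comm]

open LocalPoints in
/-- **`E(K_v)[n]` is finite** (`n ≠ 0`) — Silverman, *AEC* VII.6.3 / Milne, *ADT* I Lemma 3.3: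
it injects into `E(K_v)/U` for the torsion-free finite-index subgroup `U`.
[cite: SilvermanAEC2009, Prop. VII.6.3] -/
theorem _root_.WeierstrassCurve.finite_ker_nsmul_adicCompletion
    (W : WeierstrassCurve K) [W.IsElliptic] {n : ℕ} (hn : n ≠ 0) :
    Finite (nsmulAddMonoidHom n : (W.baseChange (v.adicCompletion K)).toAffine.Point →+ _).ker := by
  obtain ⟨U, hU, htf, -⟩ := W.exists_finiteIndex_torsionFree_adicCompletion v
  haveI := hU
  exact finite_ker_nsmul U n (htf n hn)

open LocalPoints in
/-- **`E(K_v)/n E(K_v)` is finite** (`n ≠ 0`) — the weak Mordell–Weil-type finiteness at a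
completion, Silverman, *AEC* VII.6.3 / Milne, *ADT* I Lemma 3.3 (its order is
`#E(K_v)[n] · #(O_v/n O_v) ≠ 0`). [cite: MilneADT2006, I Lemma 3.3] -/
theorem _root_.WeierstrassCurve.finite_quotient_range_nsmul_adicCompletion
    (W : WeierstrassCurve K) [W.IsElliptic] {n : ℕ} (hn : n ≠ 0) :
    Finite ((W.baseChange (v.adicCompletion K)).toAffine.Point ⧸
      (nsmulAddMonoidHom n : (W.baseChange (v.adicCompletion K)).toAffine.Point →+ _).range) := by
  haveI := W.finite_ker_nsmul_adicCompletion v hn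
  refine Nat.finite_of_card_ne_zero ?_
  rw [W.card_quotient_range_nsmul_adicCompletion v hn]
  exact mul_ne_zero Nat.card_pos.ne' (card_quotient_span_natCast_ne_zero v hn)

end NumberField

end Literature.NumberTheory.EllipticCurves

end
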